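import Summits.BirchSwinnertonDyer.Rank1Residual.GaloisImage.TwoLagrangianLinesLocal
import Summits.BirchSwinnertonDyer.Rank1Residual.GaloisImage.CongruenceVisibilityPotMult
import Summits.BirchSwinnertonDyer.Rank1Residual.GaloisImage.VisibleLowerBoundThree
import Summits.BirchSwinnertonDyer.Rank1Residual.Additive.InertialTorsionAdditive
import HarnessLib

/-!
# The refined visibility certificate with SEVEN free kinds of place: KIND (vii) at the ADDITIVE
# places `w ∤ p` with a common rational `p`-torsion line (cell `b2b-bsdres`, team n1011, row T-2LL
# "two Lagrangian lines", FILE 3; seat p04 GEN 11; skeleton `cells/n1011/skel/T-2LL.md`;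
# referee-1 GEN 36 ACK-1 provisos (i)–(vii))

HONEST FRAMING (cell `b2b-bsdres`, run/shared/lean/b2b/bsd-rank1-residual/, verbatim in every
file): the goal of the cell is to DELETE the COMBINATION-SHAPED residual classes of the
Birch–Swinnerton-Dyer formula for ALL analytic-rank `≤ 1` elliptic curves over `ℚ` — "full BSD
formula for every rank `≤ 1` curve in class `C`" assembled STRICTLY from published theorems — so
that the rank-`≤ 1` remainder becomes exactly the CONSTRUCTION-SHAPED classes, which are TYPED
(missing-input `Prop`s), NOT attempted. This is not "finishing BSD". Team n1011 (N10 / N11, the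
additive block X4 ∧ `p = 3`): research route on the CONSTRUCTION-SHAPED class X4; no claim beyond
the stated classes; nothing is booked; no mark / label / count is changed by this file. Theorems
only (no definition, no new named fact, no `sorry`). The additive comparison itself
(`TwoLagrangianLinesLocal.lean`) uses NO named fact; the assembled certificate is CONDITIONAL on the
registered Tate-uniformisation facts A40/A41 (`hU`, `hU2`) through its multiplicative kinds and, for
the `ℚ` lower-bound twins, on A24 (Cassels–Tate, `hCT`), exactly as its parents
`TwistedKummer.exists_sha_ne_zero_of_congr_of_places₆` (p09) / `VisibleLowerBoundThree.lean`. Closes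
NO class by itself — the per-row certificate (`θ`, the partner's rank, the local `p`-torsion counts,
the reduction types) is an INPUT, EVIDENCE until kernel-certified; route planner 1's counts
(ROUTE-1 §44: '+91 FAIL-other rows', 'NULL 0 / 2 306') are EVIDENCE on r1's tally, no mark moves.

## What

* `TwoLagrangianLines.h1Equiv_mem_selmerLocalKer_of_hasAdditiveReductionAt₂` /
  `relIndex_map_selmerLocalKer_eq_one_of_hasAdditiveReductionAt₂` — **KIND (vii) at an ADDITIVE
  place**: `v ∤ p`, `p` odd, BOTH `E`, `E′` additive at `v`, `#E′(K_v)[p] = p` ⟹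
  `θ_* 𝓢_v(E′) ≤ 𝓢_v(E)`, `ι_v(θ) = 1` — the inertia-torsion hypotheses of the local form are
  discharged by `Additive.inertia_torsion_of_hasAdditiveReductionAt` (p06, T-E3g-ADD FILE B:
  Kodaira–Néron over `K_v^nr`), and the count is read on the partner
  (`natCard_ker_nsmul_eq_of_congr`; referee-1 proviso (i)).
* `TwoLagrangianLines.exists_sha_ne_zero_of_congr_of_places₇` — p09's six-kind certificate
  `TwistedKummer.exists_sha_ne_zero_of_congr_of_places₆` (kinds (i), (ii), (iii), (iv′), (vi), (iii′);
  binders VERBATIM, in the same order) extended by the seventh disjunct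
  **(vii) `W.HasAdditiveReductionAt w ∧ W′.HasAdditiveReductionAt w ∧ (p : 𝓞 K) ∉ w.asIdeal ∧
  #E′(K_w)[p] = p`** — per row DECIDABLE from the reduction types and the census column `t_w`;
  `(p : 𝓞 K) ∉ w.asIdeal` stays a binder (proviso (v)).
* `Visible.{exists_sha_ne_zero_three, sq_dvd_card_sha_three, dvd_shaOrder_three,
  missingLowerBoundAt_three}_of_congr_of_places₇` — the `K = ℚ`, `p = 3` twins (siblings of
  `VisibleLowerBoundThreeNonsplit2.lean`'s `…₅`): `Ш(E)[3] ≠ 0`, `3² ∣ #Ш(E)[3^∞]` (hCT),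
  `3 ∣ #Ш(E)`, and the route's LOWER binder `MissingLowerBoundAt W 3` given `#Ш_an = q`,
  `ord₃ q ≤ 2`.

References: [CremonaMazur2000] §3 and Table 1; [AgasheStein2002] Thm. 3.1; [MilneADT2006] Ch. I
Cor. 3.4, Prop. 3.8; [PoonenRains2012] Prop. 4.10–4.11; [SilvermanATAEC1994] Ch. V;
[SilvermanAEC2009] VII.6.1, X.4.14; [Miller2011LMS] Def. 1.1; cells/n1011/ROUTE-1.md §41.3, §44.
-/

noncomputable section

open scoped Classical NumberField
open Function Field NumberField IsDedekindDomain WeierstrassCurve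
open Literature.NumberTheory.EllipticCurves Literature.NumberTheory.EllipticCurves.Rank1Residual
  Literature.NumberTheory.EllipticCurves.Rank1Residual.Typed
  Literature.NumberTheory.GaloisRepresentations

namespace Summit.BirchSwinnertonDyer.Rank1Residual.GaloisImage

namespace TwoLagrangianLines

section Additive

variable {K : Type} [Field K] [NumberField K] (W W' : WeierstrassCurve K) [W.IsElliptic]
  [W'.IsElliptic] (v : HeightOneSpectrum (𝓞 K)) {p : ℕ} [hp : Fact p.Prime]

/-- **KIND (vii) at an ADDITIVE place: `θ_* 𝓢_v(E′) ≤ 𝓢_v(E)`.** Let `p` be an odd prime,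
`v ∤ p` a finite place where BOTH `E = W` and `E′ = W′` have additive reduction, `θ : E′[p] ≃ E[p]` a
`Γ_K`-isomorphism and `#E′(K_v)[p] = p` (for `p = 3`: Kodaira types IV / IV* with `c_v = 3` on both
sides). Then the local Selmer conditions agree along `θ`. The inertia-torsion inputs of
`h1Equiv_mem_selmerLocalKer_of_inertia_torsion` hold at additive `v ∤ p`
(`Additive.inertia_torsion_of_hasAdditiveReductionAt`, Kodaira–Néron: `E(K_v^nr)[p^∞]` is killed by
`p`), and `#E(K_v)[p] = #E′(K_v)[p]` (`natCard_ker_nsmul_eq_of_congr`).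
[cite: SilvermanAEC2009, Thm. VII.6.1] [cite: MilneADT2006, Ch. I, Cor. 3.4 and Prop. 3.8]
[cite: CremonaMazur2000, §3] -/
theorem h1Equiv_mem_selmerLocalKer_of_hasAdditiveReductionAt₂
    (hW : W.HasAdditiveReductionAt v) (hW' : W'.HasAdditiveReductionAt v)
    (hpv : (p : 𝓞 K) ∉ v.asIdeal) (hp2 : p ≠ 2)
    (θ : geomTorsion W' (p : ℤ) ≃+ geomTorsion W (p : ℤ))
    (hθ : ∀ (σ : absoluteGaloisGroup K) (P : geomTorsion W' (p : ℤ)), θ (σ • P) = σ • θ P)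
    (hcard' : Nat.card (nsmulAddMonoidHom p :
      (W'.baseChange (v.adicCompletion K)).toAffine.Point →+ _).ker = p)
    {c : galH1Torsion W' (p : ℤ)} (hc : c ∈ selmerLocalKer W' (v.adicCompletion K) (p : ℤ)) :
    h1Equiv θ hθ c ∈ selmerLocalKer W (v.adicCompletion K) (p : ℤ) :=
  h1Equiv_mem_selmerLocalKer_of_inertia_torsion W W' v hpv hp2 θ hθ
    ((natCard_ker_nsmul_eq_of_congr W W' v θ hθ).trans hcard')
    (Additive.inertia_torsion_of_hasAdditiveReductionAt W p v hpv hp2 hW)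
    (Additive.inertia_torsion_of_hasAdditiveReductionAt W' p v hpv hp2 hW') hc

/-- **`ι_v(θ) = 1` at a kind-(vii) additive place** (`v ∤ p`, `p` odd, both curves additive,
`#E′(K_v)[p] = p`). [cite: CremonaMazur2000, §3] [cite: MazurRubin2004, §2.3] -/
theorem relIndex_map_selmerLocalKer_eq_one_of_hasAdditiveReductionAt₂
    (hW : W.HasAdditiveReductionAt v) (hW' : W'.HasAdditiveReductionAt v)
    (hpv : (p : 𝓞 K) ∉ v.asIdeal) (hp2 : p ≠ 2)
    (θ : geomTorsion W' (p : ℤ) ≃+ geomTorsion W (p : ℤ))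
    (hθ : ∀ (σ : absoluteGaloisGroup K) (P : geomTorsion W' (p : ℤ)), θ (σ • P) = σ • θ P)
    (hcard' : Nat.card (nsmulAddMonoidHom p :
      (W'.baseChange (v.adicCompletion K)).toAffine.Point →+ _).ker = p) :
    (selmerLocalKer W (v.adicCompletion K) (p : ℤ)).relIndex
        ((selmerLocalKer W' (v.adicCompletion K) (p : ℤ)).map (h1Equiv θ hθ).toAddMonoidHom) = 1 :=
  (relIndex_map_selmerLocalKer_eq_one_iff W W' θ hθ).mpr fun _ hc ↦
    h1Equiv_mem_selmerLocalKer_of_hasAdditiveReductionAt₂ W W' v hW hW' hpv hp2 θ hθ hcard' hc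

/-- **The refined visibility certificate with SEVEN free kinds**: `p` an odd prime,
`θ : E′[p] ⥲ E[p]` a `Γ_K`-isomorphism, `S ⊇ T` finite sets of finite places with both curves good
and `v ∤ p` outside `S`, `E(K)` finite of order prime to `p`, (a)
`∏_{v ∈ T} #E′(K_v)[p] · #(𝓞_v/p) < p^{rank E′(K)}`, and (b) every `v ∈ S \ T` of one of the free
kinds (i) `v ∤ p`, `E′(K_v)[p] = 0`; (ii) both split multiplicative, `#E(K_v)[p] ≤ p`; (iii) both
multiplicative, `γ(E) = r² γ(E′)` in `K_v`, `μ_p(K_v) = 1`; (iv′) `E` multiplicative with `γ(E)` a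
non-square in `K_v`, `E′` good, `v ∤ p`; (vi) `E` good, `E′` multiplicative with `γ(E′)` a non-square,
`v ∤ p`; (iii′) `|j(E)|_v, |j(E′)|_v > 1`, `γ(E) = r² γ(E′)`, `μ_p(K_v) = 1`; **(vii) both ADDITIVE at
`v ∤ p` with `#E′(K_v)[p] = p`**. Then `Ш(E/K)` has a non-zero element killed by `p`. The six-kind
parent is `TwistedKummer.exists_sha_ne_zero_of_congr_of_places₆`; kind (vii) is
`h1Equiv_mem_selmerLocalKer_of_hasAdditiveReductionAt₂`. Conditional on `hU` (A40), `hU2` (A41)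
through the multiplicative kinds only. [cite: CremonaMazur2000, §3 and Table 1]
[cite: AgasheStein2002, Thm. 3.1 and §3.5]
[cite: SilvermanATAEC1994, Ch. V Thm. 3.1, Lemma 5.2, Thm. 5.3, Cor. 5.4]
[cite: MilneADT2006, Ch. I Prop. 3.8] -/
theorem exists_sha_ne_zero_of_congr_of_places₇
    (hU : Silverman1994_thmV53_tateUniformisation.{0})
    (hU2 : Silverman1994_thmV53_corV54_tateUniformisation.{0})
    (hp2 : p ≠ 2)
    (θ : geomTorsion W' (p : ℤ) ≃+ geomTorsion W (p : ℤ))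
    (hθ : ∀ (σ : absoluteGaloisGroup K) (P : geomTorsion W' (p : ℤ)), θ (σ • P) = σ • θ P)
    (S T : Finset (HeightOneSpectrum (𝓞 K))) (hTS : T ⊆ S)
    (hS : ∀ w : HeightOneSpectrum (𝓞 K), w ∉ S →
      W.HasGoodReductionAt w ∧ W'.HasGoodReductionAt w ∧ (p : 𝓞 K) ∉ w.asIdeal)
    (hfin : Finite W.toAffine.Point) (hcop : (Nat.card W.toAffine.Point).Coprime p)
    (hT : (∏ w ∈ T, Nat.card (nsmulAddMonoidHom p :
        (W'.baseChange (w.adicCompletion K)).toAffine.Point →+ _).ker *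
        Nat.card (w.adicCompletionIntegers K ⧸
          Ideal.span {(p : w.adicCompletionIntegers K)})) < p ^ W'.mordellWeilRank)
    (hplaces : ∀ w ∈ S, w ∉ T →
      ((p : 𝓞 K) ∉ w.asIdeal ∧ Nat.card (nsmulAddMonoidHom p :
          (W'.baseChange (w.adicCompletion K)).toAffine.Point →+ _).ker = 1) ∨
      (W.HasSplitMultiplicativeReductionAt w ∧ W'.HasSplitMultiplicativeReductionAt w ∧
        Nat.card (nsmulAddMonoidHom p :
          (W.baseChange (w.adicCompletion K)).toAffine.Point →+ _).ker ≤ p) ∨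
      (W.HasMultiplicativeReductionAt w ∧ W'.HasMultiplicativeReductionAt w ∧
        (∃ r : w.adicCompletion K, algebraMap K (w.adicCompletion K) (-(W.c₄ / W.c₆)) =
          r ^ 2 * algebraMap K (w.adicCompletion K) (-(W'.c₄ / W'.c₆))) ∧
        (∀ ζ : w.adicCompletion K, ζ ^ p = 1 → ζ = 1)) ∨
      (W.HasMultiplicativeReductionAt w ∧
        ¬ IsSquare (algebraMap K (w.adicCompletion K) (-(W.c₄ / W.c₆))) ∧
        W'.HasGoodReductionAt w ∧ (p : 𝓞 K) ∉ w.asIdeal) ∨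
      (W.HasGoodReductionAt w ∧ W'.HasMultiplicativeReductionAt w ∧
        ¬ IsSquare (algebraMap K (w.adicCompletion K) (-(W'.c₄ / W'.c₆))) ∧
        (p : 𝓞 K) ∉ w.asIdeal) ∨
      (1 < w.valuation K W.j ∧ 1 < w.valuation K W'.j ∧
        (∃ r : w.adicCompletion K, algebraMap K (w.adicCompletion K) (-(W.c₄ / W.c₆)) =
          r ^ 2 * algebraMap K (w.adicCompletion K) (-(W'.c₄ / W'.c₆))) ∧
        (∀ ζ : w.adicCompletion K, ζ ^ p = 1 → ζ = 1)) ∨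
      (W.HasAdditiveReductionAt w ∧ W'.HasAdditiveReductionAt w ∧ (p : 𝓞 K) ∉ w.asIdeal ∧
        Nat.card (nsmulAddMonoidHom p :
          (W'.baseChange (w.adicCompletion K)).toAffine.Point →+ _).ker = p)) :
    ∃ c : W.sha, c ≠ 0 ∧ p • c = 0 := by
  have hpp : p.Prime := hp.out
  haveI := hfin
  refine exists_sha_ne_zero_of_congr_of_le_off W W' hp2 θ hθ S T hTS hS (fun w hw hwT c hc ↦ ?_) ?_
  · rcases hplaces w hw hwT with ⟨hwp, hloc⟩ | ⟨hWw, hW'w, hcardw⟩ | ⟨hWw, hW'w, hγw, hμw⟩ |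
        ⟨hWw, hγw, hW'w, hwp⟩ | ⟨hWw, hW'w, hγw, hwp⟩ | ⟨hWw, hW'w, hγw, hμw⟩ |
        ⟨hWw, hW'w, hwp, hcardw⟩
    · exact (relIndex_map_selmerLocalKer_eq_one_iff W W' θ hθ).mp
        (relIndex_map_selmerLocalKer_eq_one_of_card_torsion_eq_one W W' θ hθ hwp hloc) c hc
    · exact W.h1Equiv_mem_selmerLocalKer_of_hasSplitMultiplicativeReductionAt w hU W' θ hθ hWw
        hW'w hcardw hc
    · exact W.h1Equiv_mem_selmerLocalKer_of_hasMultiplicativeReductionAt w hU2 hp2 W' θ hθ hWw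
        hW'w hγw hμw hc
    · exact NonsplitKummer.h1Equiv_mem_selmerLocalKer_of_nonsplit_of_hasGoodReductionAt W w hU2 hp2
        W' θ hθ hWw hγw hW'w hwp hc
    · exact NonsplitKummer.h1Equiv_mem_selmerLocalKer_of_hasGoodReductionAt_of_nonsplit W W' w hU2
        hp2 θ hθ hWw hW'w hγw hwp hc
    · exact TwistedKummer.h1Equiv_mem_selmerLocalKer_of_one_lt_valuation_j W w hU2 hp2 W' θ hθ hWw
        hW'w hγw hμw hc
    · exact h1Equiv_mem_selmerLocalKer_of_hasAdditiveReductionAt₂ W W' w hWw hW'w hwp hp2 θ hθ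
        hcardw hc
  · rw [index_range_zsmul_eq_one_of_coprime hcop, one_mul,
      Finset.prod_congr rfl fun w _ ↦
        (W'.natCard_kummerLocalConditionAt_adicCompletion w hpp.ne_zero)]
    exact lt_of_lt_of_le hT (pow_mordellWeilRank_le_index_range_zsmul W' hpp.ne_zero)

end Additive

end TwoLagrangianLines

/-! ## ℚ, `p = 3`: the visible lower bound with SEVEN free kinds -/

namespace Visible

/-- **`Ш(E/ℚ)[3] ≠ 0` from a refined `3`-congruence certificate with SEVEN free kinds** (the `K = ℚ`,
`p = 3` instance of `TwoLagrangianLines.exists_sha_ne_zero_of_congr_of_places₇`): pay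
`#E′(ℚ_w)[3] · #(ℤ_w/3)` on `T` (total `< 3^{rank E′}`), and off `T` each place is of kind (i), (ii),
(iii), (iv′), (vi), (iii′) or **(vii) both curves ADDITIVE at `w ≠ 3` with `#E′(ℚ_w)[3] = 3`**
(Kodaira IV / IV*, `c_w = 3`, on both sides — route planner 1's FAIL-other class
'add-pg/add-pg (v = 2)' and its `w = 5, 7, 11, …` siblings). [cite: CremonaMazur2000, §3 and Table 1]
[cite: MilneADT2006, Ch. I Prop. 3.8] [cite: SilvermanATAEC1994, Ch. V Thm. 3.1, Lemma 5.2, Thm. 5.3, Cor. 5.4] -/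
theorem exists_sha_ne_zero_three_of_congr_of_places₇
    (hU : Silverman1994_thmV53_tateUniformisation.{0})
    (hU2 : Silverman1994_thmV53_corV54_tateUniformisation.{0})
    (W E' : WeierstrassCurve ℚ) [W.IsElliptic] [E'.IsElliptic]
    (θ : geomTorsion E' ((3 : ℕ) : ℤ) ≃+ geomTorsion W ((3 : ℕ) : ℤ))
    (hθ : ∀ (σ : absoluteGaloisGroup ℚ) (P : geomTorsion E' ((3 : ℕ) : ℤ)), θ (σ • P) = σ • θ P)
    (S T : Finset (HeightOneSpectrum (𝓞 ℚ))) (hTS : T ⊆ S)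
    (hS : ∀ w : HeightOneSpectrum (𝓞 ℚ), w ∉ S →
      W.HasGoodReductionAt w ∧ E'.HasGoodReductionAt w ∧ ((3 : ℕ) : 𝓞 ℚ) ∉ w.asIdeal)
    (hfin : Finite W.toAffine.Point) (hcop : (Nat.card W.toAffine.Point).Coprime 3)
    (hT : (∏ w ∈ T, Nat.card (nsmulAddMonoidHom 3 :
        (E'.baseChange (w.adicCompletion ℚ)).toAffine.Point →+ _).ker *
        Nat.card (w.adicCompletionIntegers ℚ ⧸
          Ideal.span {((3 : ℕ) : w.adicCompletionIntegers ℚ)})) < 3 ^ E'.mordellWeilRank)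
    (hplaces : ∀ w ∈ S, w ∉ T →
      (((3 : ℕ) : 𝓞 ℚ) ∉ w.asIdeal ∧ Nat.card (nsmulAddMonoidHom 3 :
          (E'.baseChange (w.adicCompletion ℚ)).toAffine.Point →+ _).ker = 1) ∨
      (W.HasSplitMultiplicativeReductionAt w ∧ E'.HasSplitMultiplicativeReductionAt w ∧
        Nat.card (nsmulAddMonoidHom 3 :
          (W.baseChange (w.adicCompletion ℚ)).toAffine.Point →+ _).ker ≤ 3) ∨
      (W.HasMultiplicativeReductionAt w ∧ E'.HasMultiplicativeReductionAt w ∧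
        (∃ r : w.adicCompletion ℚ, algebraMap ℚ (w.adicCompletion ℚ) (-(W.c₄ / W.c₆)) =
          r ^ 2 * algebraMap ℚ (w.adicCompletion ℚ) (-(E'.c₄ / E'.c₆))) ∧
        (∀ ζ : w.adicCompletion ℚ, ζ ^ 3 = 1 → ζ = 1)) ∨
      (W.HasMultiplicativeReductionAt w ∧
        ¬ IsSquare (algebraMap ℚ (w.adicCompletion ℚ) (-(W.c₄ / W.c₆))) ∧
        E'.HasGoodReductionAt w ∧ ((3 : ℕ) : 𝓞 ℚ) ∉ w.asIdeal) ∨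
      (W.HasGoodReductionAt w ∧ E'.HasMultiplicativeReductionAt w ∧
        ¬ IsSquare (algebraMap ℚ (w.adicCompletion ℚ) (-(E'.c₄ / E'.c₆))) ∧
        ((3 : ℕ) : 𝓞 ℚ) ∉ w.asIdeal) ∨
      (1 < w.valuation ℚ W.j ∧ 1 < w.valuation ℚ E'.j ∧
        (∃ r : w.adicCompletion ℚ, algebraMap ℚ (w.adicCompletion ℚ) (-(W.c₄ / W.c₆)) =
          r ^ 2 * algebraMap ℚ (w.adicCompletion ℚ) (-(E'.c₄ / E'.c₆))) ∧
        (∀ ζ : w.adicCompletion ℚ, ζ ^ 3 = 1 → ζ = 1)) ∨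
      (W.HasAdditiveReductionAt w ∧ E'.HasAdditiveReductionAt w ∧ ((3 : ℕ) : 𝓞 ℚ) ∉ w.asIdeal ∧
        Nat.card (nsmulAddMonoidHom 3 :
          (E'.baseChange (w.adicCompletion ℚ)).toAffine.Point →+ _).ker = 3)) :
    ∃ c : W.sha, c ≠ 0 ∧ 3 • c = 0 := by
  haveI : Fact (Nat.Prime 3) := ⟨Nat.prime_three⟩
  exact TwoLagrangianLines.exists_sha_ne_zero_of_congr_of_places₇ W E' hU hU2 (by norm_num) θ hθ S T
    hTS hS hfin hcop hT hplaces

/-- **The visible lower bound at additive `3` with SEVEN free kinds**: `3² ∣ #Ш(E)[3^∞]` for `Ш(E)`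
finite (Cassels–Tate parity, `hCT`) from the certificate of
`exists_sha_ne_zero_three_of_congr_of_places₇`. [cite: CremonaMazur2000, §3 and Table 1]
[cite: SilvermanAEC2009, Thm. X.4.14] [cite: MilneADT2006, Ch. I Prop. 3.8] -/
theorem sq_dvd_card_sha_three_of_congr_of_places₇
    (hU : Silverman1994_thmV53_tateUniformisation.{0})
    (hU2 : Silverman1994_thmV53_corV54_tateUniformisation.{0})
    (hCT : exists_casselsTate_pairing (K := ℚ))
    (W E' : WeierstrassCurve ℚ) [W.IsElliptic] [E'.IsElliptic] [Finite W.sha]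
    (θ : geomTorsion E' ((3 : ℕ) : ℤ) ≃+ geomTorsion W ((3 : ℕ) : ℤ))
    (hθ : ∀ (σ : absoluteGaloisGroup ℚ) (P : geomTorsion E' ((3 : ℕ) : ℤ)), θ (σ • P) = σ • θ P)
    (S T : Finset (HeightOneSpectrum (𝓞 ℚ))) (hTS : T ⊆ S)
    (hS : ∀ w : HeightOneSpectrum (𝓞 ℚ), w ∉ S →
      W.HasGoodReductionAt w ∧ E'.HasGoodReductionAt w ∧ ((3 : ℕ) : 𝓞 ℚ) ∉ w.asIdeal)
    (hfin : Finite W.toAffine.Point) (hcop : (Nat.card W.toAffine.Point).Coprime 3)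
    (hT : (∏ w ∈ T, Nat.card (nsmulAddMonoidHom 3 :
        (E'.baseChange (w.adicCompletion ℚ)).toAffine.Point →+ _).ker *
        Nat.card (w.adicCompletionIntegers ℚ ⧸
          Ideal.span {((3 : ℕ) : w.adicCompletionIntegers ℚ)})) < 3 ^ E'.mordellWeilRank)
    (hplaces : ∀ w ∈ S, w ∉ T →
      (((3 : ℕ) : 𝓞 ℚ) ∉ w.asIdeal ∧ Nat.card (nsmulAddMonoidHom 3 :
          (E'.baseChange (w.adicCompletion ℚ)).toAffine.Point →+ _).ker = 1) ∨
      (W.HasSplitMultiplicativeReductionAt w ∧ E'.HasSplitMultiplicativeReductionAt w ∧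
        Nat.card (nsmulAddMonoidHom 3 :
          (W.baseChange (w.adicCompletion ℚ)).toAffine.Point →+ _).ker ≤ 3) ∨
      (W.HasMultiplicativeReductionAt w ∧ E'.HasMultiplicativeReductionAt w ∧
        (∃ r : w.adicCompletion ℚ, algebraMap ℚ (w.adicCompletion ℚ) (-(W.c₄ / W.c₆)) =
          r ^ 2 * algebraMap ℚ (w.adicCompletion ℚ) (-(E'.c₄ / E'.c₆))) ∧
        (∀ ζ : w.adicCompletion ℚ, ζ ^ 3 = 1 → ζ = 1)) ∨
      (W.HasMultiplicativeReductionAt w ∧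
        ¬ IsSquare (algebraMap ℚ (w.adicCompletion ℚ) (-(W.c₄ / W.c₆))) ∧
        E'.HasGoodReductionAt w ∧ ((3 : ℕ) : 𝓞 ℚ) ∉ w.asIdeal) ∨
      (W.HasGoodReductionAt w ∧ E'.HasMultiplicativeReductionAt w ∧
        ¬ IsSquare (algebraMap ℚ (w.adicCompletion ℚ) (-(E'.c₄ / E'.c₆))) ∧
        ((3 : ℕ) : 𝓞 ℚ) ∉ w.asIdeal) ∨
      (1 < w.valuation ℚ W.j ∧ 1 < w.valuation ℚ E'.j ∧
        (∃ r : w.adicCompletion ℚ, algebraMap ℚ (w.adicCompletion ℚ) (-(W.c₄ / W.c₆)) =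
          r ^ 2 * algebraMap ℚ (w.adicCompletion ℚ) (-(E'.c₄ / E'.c₆))) ∧
        (∀ ζ : w.adicCompletion ℚ, ζ ^ 3 = 1 → ζ = 1)) ∨
      (W.HasAdditiveReductionAt w ∧ E'.HasAdditiveReductionAt w ∧ ((3 : ℕ) : 𝓞 ℚ) ∉ w.asIdeal ∧
        Nat.card (nsmulAddMonoidHom 3 :
          (E'.baseChange (w.adicCompletion ℚ)).toAffine.Point →+ _).ker = 3)) :
    3 ^ 2 ∣ Nat.card (AddCommGroup.primaryComponent W.sha 3) :=
  sq_dvd_card_sha_three_of_exists_sha_torsion hCT W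
    (exists_sha_ne_zero_three_of_congr_of_places₇ hU hU2 W E' θ hθ S T hTS hS hfin hcop hT hplaces)

/-- **`3 ∣ #Ш(E)` from the seven-kind certificate** (no Cassels–Tate, no finiteness of `Ш`:
`#Ш := Nat.card`; `Typed.dvd_shaOrder_of_exists_torsion`). [cite: CremonaMazur2000, §3 and Table 1] -/
theorem dvd_shaOrder_three_of_congr_of_places₇
    (hU : Silverman1994_thmV53_tateUniformisation.{0})
    (hU2 : Silverman1994_thmV53_corV54_tateUniformisation.{0})
    (W E' : WeierstrassCurve ℚ) [W.IsElliptic] [E'.IsElliptic]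
    (θ : geomTorsion E' ((3 : ℕ) : ℤ) ≃+ geomTorsion W ((3 : ℕ) : ℤ))
    (hθ : ∀ (σ : absoluteGaloisGroup ℚ) (P : geomTorsion E' ((3 : ℕ) : ℤ)), θ (σ • P) = σ • θ P)
    (S T : Finset (HeightOneSpectrum (𝓞 ℚ))) (hTS : T ⊆ S)
    (hS : ∀ w : HeightOneSpectrum (𝓞 ℚ), w ∉ S →
      W.HasGoodReductionAt w ∧ E'.HasGoodReductionAt w ∧ ((3 : ℕ) : 𝓞 ℚ) ∉ w.asIdeal)
    (hfin : Finite W.toAffine.Point) (hcop : (Nat.card W.toAffine.Point).Coprime 3)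
    (hT : (∏ w ∈ T, Nat.card (nsmulAddMonoidHom 3 :
        (E'.baseChange (w.adicCompletion ℚ)).toAffine.Point →+ _).ker *
        Nat.card (w.adicCompletionIntegers ℚ ⧸
          Ideal.span {((3 : ℕ) : w.adicCompletionIntegers ℚ)})) < 3 ^ E'.mordellWeilRank)
    (hplaces : ∀ w ∈ S, w ∉ T →
      (((3 : ℕ) : 𝓞 ℚ) ∉ w.asIdeal ∧ Nat.card (nsmulAddMonoidHom 3 :
          (E'.baseChange (w.adicCompletion ℚ)).toAffine.Point →+ _).ker = 1) ∨
      (W.HasSplitMultiplicativeReductionAt w ∧ E'.HasSplitMultiplicativeReductionAt w ∧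
        Nat.card (nsmulAddMonoidHom 3 :
          (W.baseChange (w.adicCompletion ℚ)).toAffine.Point →+ _).ker ≤ 3) ∨
      (W.HasMultiplicativeReductionAt w ∧ E'.HasMultiplicativeReductionAt w ∧
        (∃ r : w.adicCompletion ℚ, algebraMap ℚ (w.adicCompletion ℚ) (-(W.c₄ / W.c₆)) =
          r ^ 2 * algebraMap ℚ (w.adicCompletion ℚ) (-(E'.c₄ / E'.c₆))) ∧
        (∀ ζ : w.adicCompletion ℚ, ζ ^ 3 = 1 → ζ = 1)) ∨
      (W.HasMultiplicativeReductionAt w ∧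
        ¬ IsSquare (algebraMap ℚ (w.adicCompletion ℚ) (-(W.c₄ / W.c₆))) ∧
        E'.HasGoodReductionAt w ∧ ((3 : ℕ) : 𝓞 ℚ) ∉ w.asIdeal) ∨
      (W.HasGoodReductionAt w ∧ E'.HasMultiplicativeReductionAt w ∧
        ¬ IsSquare (algebraMap ℚ (w.adicCompletion ℚ) (-(E'.c₄ / E'.c₆))) ∧
        ((3 : ℕ) : 𝓞 ℚ) ∉ w.asIdeal) ∨
      (1 < w.valuation ℚ W.j ∧ 1 < w.valuation ℚ E'.j ∧
        (∃ r : w.adicCompletion ℚ, algebraMap ℚ (w.adicCompletion ℚ) (-(W.c₄ / W.c₆)) =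
          r ^ 2 * algebraMap ℚ (w.adicCompletion ℚ) (-(E'.c₄ / E'.c₆))) ∧
        (∀ ζ : w.adicCompletion ℚ, ζ ^ 3 = 1 → ζ = 1)) ∨
      (W.HasAdditiveReductionAt w ∧ E'.HasAdditiveReductionAt w ∧ ((3 : ℕ) : 𝓞 ℚ) ∉ w.asIdeal ∧
        Nat.card (nsmulAddMonoidHom 3 :
          (E'.baseChange (w.adicCompletion ℚ)).toAffine.Point →+ _).ker = 3)) :
    3 ∣ W.shaOrder := by
  haveI : Fact (Nat.Prime 3) := ⟨Nat.prime_three⟩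
  exact Typed.dvd_shaOrder_of_exists_torsion W 3
    (exists_sha_ne_zero_three_of_congr_of_places₇ hU hU2 W E' θ hθ S T hTS hS hfin hcop hT hplaces)

/-- **The route's LOWER binder from a seven-kind congruence certificate**: `MissingLowerBoundAt W 3`
for a globally minimal `E = W` with `Ш(E)` finite, `#Ш(E)_an = q` rational with `ord₃ q ≤ 2`
(`3 ∣ #Ш` from the certificate and `#Ш` a square, Cassels–Tate; as
`missingLowerBoundAt_three_of_congr_of_places₅`). [cite: Miller2011LMS, §1 and Def. 1.1]
[cite: SilvermanAEC2009, Thm. X.4.14] [cite: CremonaMazur2000, §3 and Table 1] -/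
theorem missingLowerBoundAt_three_of_congr_of_places₇
    (hU : Silverman1994_thmV53_tateUniformisation.{0})
    (hU2 : Silverman1994_thmV53_corV54_tateUniformisation.{0})
    (hCT : exists_casselsTate_pairing (K := ℚ))
    (W E' : WeierstrassCurve ℚ) [W.IsElliptic] [W.IsGloballyMinimal] [E'.IsElliptic]
    (θ : geomTorsion E' ((3 : ℕ) : ℤ) ≃+ geomTorsion W ((3 : ℕ) : ℤ))
    (hθ : ∀ (σ : absoluteGaloisGroup ℚ) (P : geomTorsion E' ((3 : ℕ) : ℤ)), θ (σ • P) = σ • θ P)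
    (S T : Finset (HeightOneSpectrum (𝓞 ℚ))) (hTS : T ⊆ S)
    (hS : ∀ w : HeightOneSpectrum (𝓞 ℚ), w ∉ S →
      W.HasGoodReductionAt w ∧ E'.HasGoodReductionAt w ∧ ((3 : ℕ) : 𝓞 ℚ) ∉ w.asIdeal)
    (hfin : Finite W.toAffine.Point) (hcop : (Nat.card W.toAffine.Point).Coprime 3)
    (hT : (∏ w ∈ T, Nat.card (nsmulAddMonoidHom 3 :
        (E'.baseChange (w.adicCompletion ℚ)).toAffine.Point →+ _).ker *
        Nat.card (w.adicCompletionIntegers ℚ ⧸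
          Ideal.span {((3 : ℕ) : w.adicCompletionIntegers ℚ)})) < 3 ^ E'.mordellWeilRank)
    (hplaces : ∀ w ∈ S, w ∉ T →
      (((3 : ℕ) : 𝓞 ℚ) ∉ w.asIdeal ∧ Nat.card (nsmulAddMonoidHom 3 :
          (E'.baseChange (w.adicCompletion ℚ)).toAffine.Point →+ _).ker = 1) ∨
      (W.HasSplitMultiplicativeReductionAt w ∧ E'.HasSplitMultiplicativeReductionAt w ∧
        Nat.card (nsmulAddMonoidHom 3 :
          (W.baseChange (w.adicCompletion ℚ)).toAffine.Point →+ _).ker ≤ 3) ∨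
      (W.HasMultiplicativeReductionAt w ∧ E'.HasMultiplicativeReductionAt w ∧
        (∃ r : w.adicCompletion ℚ, algebraMap ℚ (w.adicCompletion ℚ) (-(W.c₄ / W.c₆)) =
          r ^ 2 * algebraMap ℚ (w.adicCompletion ℚ) (-(E'.c₄ / E'.c₆))) ∧
        (∀ ζ : w.adicCompletion ℚ, ζ ^ 3 = 1 → ζ = 1)) ∨
      (W.HasMultiplicativeReductionAt w ∧
        ¬ IsSquare (algebraMap ℚ (w.adicCompletion ℚ) (-(W.c₄ / W.c₆))) ∧
        E'.HasGoodReductionAt w ∧ ((3 : ℕ) : 𝓞 ℚ) ∉ w.asIdeal) ∨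
      (W.HasGoodReductionAt w ∧ E'.HasMultiplicativeReductionAt w ∧
        ¬ IsSquare (algebraMap ℚ (w.adicCompletion ℚ) (-(E'.c₄ / E'.c₆))) ∧
        ((3 : ℕ) : 𝓞 ℚ) ∉ w.asIdeal) ∨
      (1 < w.valuation ℚ W.j ∧ 1 < w.valuation ℚ E'.j ∧
        (∃ r : w.adicCompletion ℚ, algebraMap ℚ (w.adicCompletion ℚ) (-(W.c₄ / W.c₆)) =
          r ^ 2 * algebraMap ℚ (w.adicCompletion ℚ) (-(E'.c₄ / E'.c₆))) ∧
        (∀ ζ : w.adicCompletion ℚ, ζ ^ 3 = 1 → ζ = 1)) ∨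
      (W.HasAdditiveReductionAt w ∧ E'.HasAdditiveReductionAt w ∧ ((3 : ℕ) : 𝓞 ℚ) ∉ w.asIdeal ∧
        Nat.card (nsmulAddMonoidHom 3 :
          (E'.baseChange (w.adicCompletion ℚ)).toAffine.Point →+ _).ker = 3))
    (hSha : W.ShaFinite) {q : ℚ} (hq : shaAn W = (q : ℂ)) (hv : padicValRat 3 q ≤ 2) :
    MissingLowerBoundAt W 3 := by
  haveI : Fact (Nat.Prime 3) := ⟨Nat.prime_three⟩
  refine Typed.missingLowerBoundAt_of_casselsTate_of_pow_dvd W 3 hCT hSha hq (k := 1)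
    (by simpa using hv) ?_
  simpa using dvd_shaOrder_three_of_congr_of_places₇ hU hU2 W E' θ hθ S T hTS hS hfin hcop hT
    hplaces

end Visible

end Summit.BirchSwinnertonDyer.Rank1Residual.GaloisImage

end
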